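import Summits.ABC.ABC.Theses.IsogenyGlueCongruence
import Summits.ABC.ABC.Theorems.IsogenyGlueCongruenceEllipticGluingPrimeBoundStubFreeOfSimple
import Summits.ABC.ABC.Theorems.IsogenyGlueCongruenceEllipticGluingPrimeBoundStubEndFieldDichotomy
import Summits.ABC.ABC.Theorems.IsogenyGlueCongruenceEllipticGluingPrimeBoundStubImageDichotomyCore
import Literature.NumberTheory.EllipticCurves.BSDSelmerSkinnerProofs
import Literature.NumberTheory.EllipticCurves.ComplexMultiplicationHasCMIffHoldsProofs
import Literature.NumberTheory.EllipticCurves.ModularityVersionApProofs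
import Literature.NumberTheory.EllipticCurves.RootNumberProofs
import Literature.AlgebraicGeometry.Motives.AbelianVarietyEndGaloisDescent
import Literature.NumberTheory.GaloisRepresentations.AbsGaloisGroup
import HarnessLib

/-!
# Crux U `EllipticGluingPrimeBound` (stmt-ABC-13919), line `SketchIdeator5` — pointwise bricks of
# the semistable restriction: no CM for semistable curves, free and ℚ-simple partners at a fixed curve

First half of the certificate "U_ss ⟸ R_gen,ss" (skeleton v13; second half and the registered stub
`stub_semistableOfGeneric` in …SemistableOfGeneric.lean).  The route consumes the crux U only
through its semistable restriction `U_ss` (…Semistable.lean, p141036); to derive `U_ss` from the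
generic residual R_gen ALONE one runs the landed compositions POINTWISE in the curve `W` — at a
semistable `W`, which has no CM — instead of globally (where the CM branch drags in R_cm^unif and
`FaltingsTate`).  This file proves:

* `not_hasCM_of_isSemistable` — a semistable `W/ℚ` of conductor `≠ 1` has no CM: a prime `p ∣ N`
  is a prime of bad, hence multiplicative, reduction, where `j` is not `p`-integral, while the
  thirteen CM `j`-invariants are integers (`not_hasCM_of_hasMultiplicativeReductionAtPrime` with the
  tree's theorem `j_mem_cmJInvariants_of_hasCM_holds`, and the prime/place bridges of
  `RootNumberProofs`);
* `freeBound_at` — geometrically `E`-free partners from ℚ-simple ones at a fixed `W` (the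
  induction on `dim A` of `stub_freeOfSimple`, p117567, with the simple case assumed at `W` only);
* `simpleBound_at_of_generic` — ℚ-simple partners of a NON-CM `W` from Masser–Wüstholz
  surjectivity at `W` and R_gen at `W` (the non-CM half of `simpleFreeTorsionBound_of_slices`,
  p126491: small `ℓ` absorbed; else `ρ̄_{W,ℓ}` surjective and the landed end-field dichotomy
  `stub_endFieldDichotomy`/`stub_imageDichotomyCore` gives `ℓ ≤ 4 dim² + 1` or a full congruence);
* `stub_simpleBoundAtOfGeneric` — its uncurried registered form.

No definitions; no named facts; no `sorry`; standard axioms.  Lands `--supports stmt-ABC-13919`.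
-/

noncomputable section

-- `Summit.<Summit>.<Problem>` is the mandated summit-side namespace (CONVENTIONS §2); for the
-- single-conjunct summit `ABC` the two coincide, so the duplicate `ABC.ABC` is deliberate.
set_option linter.dupNamespace false

namespace Summit.ABC.ABC.Theorems.GluingSlices

open CategoryTheory CategoryTheory.Limits AlgebraicGeometry
open Literature.AlgebraicGeometry.Motives
open Summit.ABC.ABC.Theses.IsogenyGlueCongruence
open Summit.ABC.ABC.Theorems.IsotypicMinkowski
open Literature.NumberTheory.EllipticCurves Literature.NumberTheory.DiophantineGeometry
open IsDedekindDomain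

/-! ### A semistable curve of conductor `≠ 1` has no CM -/

/-- **A semistable elliptic curve over `ℚ` of conductor `≠ 1` has no complex multiplication.**
A prime `p ∣ N` is a prime of bad reduction (`dvd_conductorNorm_iff_not_hasGoodReductionAtPrime`),
hence — `W` being semistable at the place above `p` — of multiplicative reduction
(`hasGoodReductionAtPrime_iff_hasGoodReductionAt_holds`,
`hasMultiplicativeReductionAtPrime_iff_hasMultiplicativeReductionAt_holds`), and a curve with a
multiplicative prime has no CM (`not_hasCM_of_hasMultiplicativeReductionAtPrime`: `j` is not
`p`-integral there, while the thirteen CM `j`-invariants are integers,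
`j_mem_cmJInvariants_of_hasCM_holds`). -/
theorem not_hasCM_of_isSemistable (W : WeierstrassCurve ℚ) [W.IsElliptic]
    (hss : W.IsSemistable ℤ) (hN1 : W.conductorNorm ℤ ≠ 1) : ¬ W.HasCM := by
  obtain ⟨p, hp, hpN⟩ := Nat.exists_prime_and_dvd hN1
  haveI : Fact p.Prime := ⟨hp⟩
  have hbad : ¬ W.HasGoodReductionAtPrime p :=
    (W.dvd_conductorNorm_iff_not_hasGoodReductionAtPrime p).mp hpN
  have hmult : W.HasMultiplicativeReductionAtPrime p := by
    rcases hss ((Rat.HeightOneSpectrum.primesEquiv (R := ℤ)).symm ⟨p, hp⟩) with hgood | hmul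
    · exact absurd ((W.hasGoodReductionAtPrime_iff_hasGoodReductionAt_holds ⟨p, hp⟩).mpr hgood) hbad
    · exact (W.hasMultiplicativeReductionAtPrime_iff_hasMultiplicativeReductionAt_holds ⟨p, hp⟩).mpr
        hmul
  exact not_hasCM_of_hasMultiplicativeReductionAtPrime j_mem_cmJInvariants_of_hasCM_holds W hmult

/-! ### Free and ℚ-simple partners at a fixed curve -/

/-- **Free partners from ℚ-simple ones, at a fixed curve** (the induction of `stub_freeOfSimple`,
pointwise in `W`): with `C ≥ 0`, the simple case `hS` at `W` and the quotient construction `hQ`,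
the bound `ℓ ≤ C ((dim A + 1) max(1, h_F W))^κ` holds for every geometrically `E`-free `A/ℚ` of
dimension `≤ n` carrying an equivariant embedding `W[ℓ] ↪ A(ℚ̄)` at a prime `ℓ` of irreducible
`W[ℓ]` — a non-simple `A` has a closed immersion `i : A₁ ↪ A` with `0 < dim A₁ < dim A`, and the
`Γ_ℚ`-stable preimage of `i(A₁(ℚ̄))` in `W[ℓ]` is `⊤` (embed into `A₁`) or `⊥` (embed into the
quotient `Z'`), both of smaller dimension. -/
theorem freeBound_at {W : WeierstrassCurve ℚ} [W.IsElliptic] (E : AbelianVariety.{0} ℚ)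
    {κ C : ℝ} (hκ : 0 ≤ κ) (hC : 0 ≤ C)
    (hS : ∀ (A : AbelianVariety.{0} ℚ),
      (∀ f : E.baseChange (AlgebraicClosure ℚ) ⟶ A.baseChange (AlgebraicClosure ℚ), f = 0) →
      AbelianVariety.IsSimple A →
      ∀ ℓ : ℕ, ℓ.Prime → W.HasIrreducibleModPGaloisRep ℓ →
      (∃ ι : W.geomTorsion ℓ →+ A.geomPoints, Function.Injective ι ∧
        ∀ (σ : Field.absoluteGaloisGroup ℚ) (P : W.geomTorsion ℓ), ι (σ • P) = σ • ι P) →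
        (ℓ : ℝ) ≤ C * (((A.dim : ℝ) + 1) * max 1 W.stableFaltingsHeight) ^ κ)
    (hQ : ∀ (A A₁ : AbelianVariety.{0} ℚ) (i : A₁ ⟶ A),
      IsClosedImmersion (AbelianVariety.Hom.toSchemeHom i) →
      ∃ (Z' : AbelianVariety.{0} ℚ) (Φ : A.geomPoints →+ Z'.geomPoints),
        Z'.dim + A₁.dim = A.dim ∧
        (∀ (σ : Field.absoluteGaloisGroup ℚ) (P : A.geomPoints), Φ (σ • P) = σ • Φ P) ∧
        (∀ P : A.geomPoints, Φ P = 0 ↔ P ∈ (AbelianVariety.Hom.geomPointsMap i).range) ∧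
        ∀ X : AbelianVariety.{0} (AlgebraicClosure ℚ),
          (∀ f : X ⟶ A.baseChange (AlgebraicClosure ℚ), f = 0) →
          ∀ f : X ⟶ Z'.baseChange (AlgebraicClosure ℚ), f = 0)
    (n : ℕ) {ℓ : ℕ} (hℓ : ℓ.Prime) (hirr : W.HasIrreducibleModPGaloisRep ℓ) (A : AbelianVariety.{0} ℚ)
    (hfree : ∀ f : E.baseChange (AlgebraicClosure ℚ) ⟶ A.baseChange (AlgebraicClosure ℚ), f = 0)
    (ι : W.geomTorsion ℓ →+ A.geomPoints) (hι : Function.Injective ι)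
    (hιe : ∀ (σ : Field.absoluteGaloisGroup ℚ) (P : W.geomTorsion ℓ), ι (σ • P) = σ • ι P)
    (hdim : A.dim ≤ n) :
    (ℓ : ℝ) ≤ C * (((A.dim : ℝ) + 1) * max 1 W.stableFaltingsHeight) ^ κ := by
  induction n generalizing A with
  | zero =>
    exact hS A hfree (AbelianVariety.isSimple_of_dim_le_one (by omega)) ℓ hℓ hirr ⟨ι, hι, hιe⟩
  | succ n ih =>
    by_cases hsim : AbelianVariety.IsSimple A
    · exact hS A hfree hsim ℓ hℓ hirr ⟨ι, hι, hιe⟩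
    -- a non-zero proper abelian subvariety `i : A₁ ↪ A`
    obtain ⟨A₁, i, hi, hpos, hlt⟩ : ∃ (A₁ : AbelianVariety.{0} ℚ) (i : A₁ ⟶ A),
        IsClosedImmersion (AbelianVariety.Hom.toSchemeHom i) ∧ 0 < A₁.dim ∧ A₁.dim < A.dim := by
      by_contra hne
      exact hsim fun B f h1 h2 h3 ↦ hne ⟨B, f, h1, h2, h3⟩
    haveI := hi
    have hinj : Function.Injective (AbelianVariety.Hom.geomPointsMap i) :=
      geomPointsMap_injective_of_isClosedImmersion' i
    have hm0 : (0 : ℝ) ≤ max 1 W.stableFaltingsHeight := zero_le_one.trans (le_max_left _ _)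
    -- `H = ι⁻¹ (i A₁(ℚ̄))`, a `Γ_ℚ`-stable subgroup of `W[ℓ]`, is `⊥` or `⊤`
    obtain ⟨H, hH⟩ : ∃ H : AddSubgroup (W.geomTorsion ℓ),
        H = (AbelianVariety.Hom.geomPointsMap i).range.comap ι := ⟨_, rfl⟩
    have hmemH : ∀ P : W.geomTorsion ℓ,
        P ∈ H ↔ ι P ∈ (AbelianVariety.Hom.geomPointsMap i).range := by
      intro P
      rw [hH, AddSubgroup.mem_comap]
    have hstab : ∀ (σ : Field.absoluteGaloisGroup ℚ), ∀ P ∈ H, σ • P ∈ H := by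
      intro σ P hP
      rw [hmemH] at hP ⊢
      obtain ⟨a, ha⟩ := AddMonoidHom.mem_range.1 hP
      refine AddMonoidHom.mem_range.2 ⟨σ • a, ?_⟩
      rw [AbelianVariety.Hom.geomPointsMap_smul, ha, hιe]
    rcases hirr H hstab with hbot | htop
    · -- `W[ℓ]` meets `A₁` trivially: embed `W[ℓ]` into the quotient `Z'` through `Φ`
      obtain ⟨Z', Φ, hdimZ, hΦσ, hΦker, hΦfree⟩ := hQ A A₁ i hi
      have hι' : Function.Injective (Φ.comp ι) := by
        rw [injective_iff_map_eq_zero]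
        intro P hP
        have hPH : P ∈ H := (hmemH P).2 ((hΦker (ι P)).1 hP)
        rw [hbot] at hPH
        exact AddSubgroup.mem_bot.1 hPH
      have hι'e : ∀ (σ : Field.absoluteGaloisGroup ℚ) (P : W.geomTorsion ℓ),
          Φ.comp ι (σ • P) = σ • Φ.comp ι P := by
        intro σ P
        rw [AddMonoidHom.comp_apply, AddMonoidHom.comp_apply, hιe, hΦσ]
      have hZ := ih Z' (hΦfree _ hfree) (Φ.comp ι) hι' hι'e (by omega)
      exact le_bound_of_dim_le hC hκ hm0 (by omega) hZ
    · -- `W[ℓ]` lands in `A₁`: restrict `ι` to `A₁`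
      have hrange : ∀ P : W.geomTorsion ℓ, ι P ∈ (AbelianVariety.Hom.geomPointsMap i).range := by
        intro P
        rw [← hmemH, htop]
        exact AddSubgroup.mem_top P
      obtain ⟨ι₁, hι₁, hι₁e⟩ := exists_lift_of_forall_mem_range (AbelianVariety.Hom.geomPointsMap i)
        hinj (fun σ a ↦ AbelianVariety.Hom.geomPointsMap_smul i σ a) ι hι hιe hrange
      have h₁ := ih A₁ (isGeomFree_of_isClosedImmersion (E := E) i hfree) ι₁ hι₁ hι₁e (by omega)
      exact le_bound_of_dim_le hC hκ hm0 hlt.le h₁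

/-- **ℚ-simple partners of a NON-CM curve from R_gen at that curve** (the non-CM half of
`simpleFreeTorsionBound_of_slices`, pointwise in `W`): small `ℓ` (`ℓ ≤ c · max(1,h)^γ` or `ℓ < 5`)
is absorbed by the constant; otherwise `ρ̄_{W,ℓ}` is surjective (MW at `W`) and the landed
end-field dichotomy gives either `ℓ ≤ 4 dim² + 1 ≤ 5 X²` or a congruence that is full over the
endomorphism field, where R_gen at `W` applies.  Exponent `max 2 (max γ κ₁)`, constant
`5 + max c 0 + max C₁ 0`, base `X = (dim A + 1) · max(1, h_F W) ≥ 1`. -/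
theorem simpleBound_at_of_generic {W : WeierstrassCurve ℚ} [W.IsElliptic] (hcm : ¬ W.HasCM)
    {c γ : ℝ} (hγ : 0 ≤ γ)
    (hMW : ∀ ℓ : ℕ, ℓ.Prime → c * (max 1 W.stableFaltingsHeight) ^ γ < ℓ →
      W.HasSurjectiveModNGaloisRep ℓ)
    {κ₁ C₁ : ℝ}
    (hG : ∀ (E A : AbelianVariety.{0} ℚ) (e : E.geomPoints ≃+ W.geomPoints),
      (∀ (σ : Field.absoluteGaloisGroup ℚ) (P : E.geomPoints), e (σ • P) = σ • e P) →
      (∀ f : E.baseChange (AlgebraicClosure ℚ) ⟶ A.baseChange (AlgebraicClosure ℚ), f = 0) →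
      AbelianVariety.IsSimple A → ¬ W.HasCM →
      ∀ ℓ : ℕ, ℓ.Prime → 5 ≤ ℓ → W.HasSurjectiveModNGaloisRep ℓ →
      (∀ g ∈ commutator (Multiplicative (AddAut (W.geomTorsion ℓ))),
        ∃ σ : Field.absoluteGaloisGroup ℚ,
          (∀ r : A.baseChange (AlgebraicClosure ℚ) ⟶ A.baseChange (AlgebraicClosure ℚ),
            A.galConj (AlgebraicClosure ℚ) (Field.absoluteGaloisGroup.toAlgEquiv ℚ σ) r = r) ∧
          W.galoisRepTorsion ℓ σ = g) →
      (∃ ι : W.geomTorsion ℓ →+ A.geomPoints, Function.Injective ι ∧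
        ∀ (σ : Field.absoluteGaloisGroup ℚ) (P : W.geomTorsion ℓ), ι (σ • P) = σ • ι P) →
        (ℓ : ℝ) ≤ C₁ * (((A.dim : ℝ) + 1) * max 1 W.stableFaltingsHeight) ^ κ₁)
    (E A : AbelianVariety.{0} ℚ) (e : E.geomPoints ≃+ W.geomPoints)
    (he : ∀ (σ : Field.absoluteGaloisGroup ℚ) (P : E.geomPoints), e (σ • P) = σ • e P)
    (hfree : ∀ f : E.baseChange (AlgebraicClosure ℚ) ⟶ A.baseChange (AlgebraicClosure ℚ), f = 0)
    (hsimp : AbelianVariety.IsSimple A) {ℓ : ℕ} (hℓ : ℓ.Prime)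
    (hι : ∃ ι : W.geomTorsion ℓ →+ A.geomPoints, Function.Injective ι ∧
      ∀ (σ : Field.absoluteGaloisGroup ℚ) (P : W.geomTorsion ℓ), ι (σ • P) = σ • ι P) :
    (ℓ : ℝ) ≤ (5 + max c 0 + max C₁ 0) *
      (((A.dim : ℝ) + 1) * max 1 W.stableFaltingsHeight) ^ (max 2 (max γ κ₁)) := by
  have hD := stub_endFieldDichotomy stub_imageDichotomyCore
  set κ : ℝ := max 2 (max γ κ₁) with hκdef
  set K : ℝ := 5 + max c 0 + max C₁ 0 with hKdef
  set X : ℝ := ((A.dim : ℝ) + 1) * max 1 W.stableFaltingsHeight with hX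
  have hh : (1 : ℝ) ≤ max 1 W.stableFaltingsHeight := le_max_left _ _
  have hm0 : (0 : ℝ) ≤ max 1 W.stableFaltingsHeight := zero_le_one.trans hh
  have hdim1 : (1 : ℝ) ≤ (A.dim : ℝ) + 1 := by
    have : (0 : ℝ) ≤ (A.dim : ℝ) := Nat.cast_nonneg _
    linarith
  have hX1 : 1 ≤ X := by rw [hX]; nlinarith
  have hX0 : 0 ≤ X := zero_le_one.trans hX1
  have hmX : max 1 W.stableFaltingsHeight ≤ X := by
    rw [hX]
    calc max 1 W.stableFaltingsHeight = 1 * max 1 W.stableFaltingsHeight := (one_mul _).symm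
      _ ≤ ((A.dim : ℝ) + 1) * max 1 W.stableFaltingsHeight := mul_le_mul_of_nonneg_right hdim1 hm0
  have hκ2 : 2 ≤ κ := le_max_left _ _
  have hκ0 : 0 ≤ κ := zero_le_two.trans hκ2
  have hγκ : γ ≤ κ := (le_max_left _ _).trans (le_max_right _ _)
  have hκ₁κ : κ₁ ≤ κ := (le_max_right _ _).trans (le_max_right _ _)
  have hXpow1 : 1 ≤ X ^ κ := Real.one_le_rpow hX1 hκ0
  have hXpow0 : 0 ≤ X ^ κ := zero_le_one.trans hXpow1
  have hc0 : (0 : ℝ) ≤ max c 0 := le_max_right _ _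
  have hC₁0 : (0 : ℝ) ≤ max C₁ 0 := le_max_right _ _
  have hK5 : (5 : ℝ) ≤ K := by rw [hKdef]; linarith
  have hK0 : (0 : ℝ) ≤ K := by linarith
  -- absorbing a partial bound `ℓ ≤ K' * X ^ κ'` with `K' ≤ K`, `κ' ≤ κ`
  have key : ∀ K' κ' : ℝ, K' ≤ K → κ' ≤ κ → (ℓ : ℝ) ≤ K' * X ^ κ' → (ℓ : ℝ) ≤ K * X ^ κ := by
    intro K' κ' hK' hκ' hb
    have hK'0 : 0 ≤ max K' 0 := le_max_right _ _
    calc (ℓ : ℝ) ≤ K' * X ^ κ' := hb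
      _ ≤ max K' 0 * X ^ κ' := mul_le_mul_of_nonneg_right (le_max_left _ _) (Real.rpow_nonneg hX0 _)
      _ ≤ max K' 0 * X ^ κ :=
          mul_le_mul_of_nonneg_left (Real.rpow_le_rpow_of_exponent_le hX1 hκ') hK'0
      _ ≤ K * X ^ κ := mul_le_mul_of_nonneg_right (max_le hK' hK0) hXpow0
  -- constants are absorbed: `ℓ ≤ K` suffices whenever `ℓ ≤ 5`
  have small : (ℓ : ℝ) ≤ 5 → (ℓ : ℝ) ≤ K * X ^ κ := by
    intro h5
    calc (ℓ : ℝ) ≤ K := h5.trans hK5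
      _ = K * 1 := (mul_one K).symm
      _ ≤ K * X ^ κ := mul_le_mul_of_nonneg_left hXpow1 hK0
  by_cases hsm : (ℓ : ℝ) ≤ c * (max 1 W.stableFaltingsHeight) ^ γ
  · -- below the surjectivity threshold
    have hb : (ℓ : ℝ) ≤ max c 0 * X ^ γ :=
      calc (ℓ : ℝ) ≤ c * (max 1 W.stableFaltingsHeight) ^ γ := hsm
        _ ≤ max c 0 * (max 1 W.stableFaltingsHeight) ^ γ :=
            mul_le_mul_of_nonneg_right (le_max_left _ _) (Real.rpow_nonneg hm0 _)
        _ ≤ max c 0 * X ^ γ :=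
            mul_le_mul_of_nonneg_left (Real.rpow_le_rpow hm0 hmX hγ) hc0
    refine key (max c 0) γ ?_ hγκ hb
    rw [hKdef]; linarith
  · have hsurj : W.HasSurjectiveModNGaloisRep ℓ := hMW ℓ hℓ (lt_of_not_ge hsm)
    by_cases h5 : ℓ < 5
    · exact small (by exact_mod_cast h5.le)
    · have h5' : 5 ≤ ℓ := not_lt.mp h5
      rcases hD W A ℓ hℓ h5' hsurj with hb | hfull
      · -- the dichotomy's bound: `ℓ ≤ 4 dim² + 1 ≤ 5 X ^ 2 ≤ 5 X ^ κ`
        have hbR : (ℓ : ℝ) ≤ 4 * (A.dim : ℝ) ^ 2 + 1 := by exact_mod_cast hb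
        have hd0 : (0 : ℝ) ≤ (A.dim : ℝ) := Nat.cast_nonneg _
        have h1 : 4 * (A.dim : ℝ) ^ 2 + 1 ≤ 5 * X ^ (2 : ℝ) := by
          rw [Real.rpow_two, hX]
          nlinarith [hh, hm0, hd0, sq_nonneg ((A.dim : ℝ) + 1),
            mul_le_mul_of_nonneg_left hh (sq_nonneg ((A.dim : ℝ) + 1))]
        refine key 5 2 ?_ hκ2 (hbR.trans h1)
        rw [hKdef]; linarith
      · -- the congruence is full over `L_A`: the generic residual at `W`
        have hb := hG E A e he hfree hsimp hcm ℓ hℓ h5' hsurj hfull hι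
        refine key C₁ κ₁ ?_ hκ₁κ hb
        rw [hKdef]
        have : C₁ ≤ max C₁ 0 := le_max_left _ _
        linarith

/-- **Registered stub `stub_simpleBoundAtOfGeneric` (skeleton v13 of line `SketchIdeator5`)** —
the uncurried registered form of `simpleBound_at_of_generic`: at a non-CM curve `W`, Masser–Wüstholz
surjectivity at `W` and the generic residual R_gen at `W` bound every prime of a torsion sharing
`W[ℓ] ↪ A(ℚ̄)` with a ℚ-simple geometrically `E`-free partner `A`. -/
theorem stub_simpleBoundAtOfGeneric :
    ∀ (W : WeierstrassCurve ℚ) [W.IsElliptic], ¬ W.HasCM → ∀ (c γ : ℝ), 0 ≤ γ →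
      (∀ ℓ : ℕ, ℓ.Prime → c * (max 1 W.stableFaltingsHeight) ^ γ < ℓ →
        W.HasSurjectiveModNGaloisRep ℓ) →
      ∀ (κ₁ C₁ : ℝ),
      (∀ (E A : AbelianVariety.{0} ℚ) (e : E.geomPoints ≃+ W.geomPoints),
        (∀ (σ : Field.absoluteGaloisGroup ℚ) (P : E.geomPoints), e (σ • P) = σ • e P) →
        (∀ f : E.baseChange (AlgebraicClosure ℚ) ⟶ A.baseChange (AlgebraicClosure ℚ), f = 0) →
        AbelianVariety.IsSimple A → ¬ W.HasCM →
        ∀ ℓ : ℕ, ℓ.Prime → 5 ≤ ℓ → W.HasSurjectiveModNGaloisRep ℓ →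
        (∀ g ∈ commutator (Multiplicative (AddAut (W.geomTorsion ℓ))),
          ∃ σ : Field.absoluteGaloisGroup ℚ,
            (∀ r : A.baseChange (AlgebraicClosure ℚ) ⟶ A.baseChange (AlgebraicClosure ℚ),
              A.galConj (AlgebraicClosure ℚ) (Field.absoluteGaloisGroup.toAlgEquiv ℚ σ) r = r) ∧
            W.galoisRepTorsion ℓ σ = g) →
        (∃ ι : W.geomTorsion ℓ →+ A.geomPoints, Function.Injective ι ∧
          ∀ (σ : Field.absoluteGaloisGroup ℚ) (P : W.geomTorsion ℓ), ι (σ • P) = σ • ι P) →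
          (ℓ : ℝ) ≤ C₁ * (((A.dim : ℝ) + 1) * max 1 W.stableFaltingsHeight) ^ κ₁) →
      ∀ (E A : AbelianVariety.{0} ℚ) (e : E.geomPoints ≃+ W.geomPoints),
      (∀ (σ : Field.absoluteGaloisGroup ℚ) (P : E.geomPoints), e (σ • P) = σ • e P) →
      (∀ f : E.baseChange (AlgebraicClosure ℚ) ⟶ A.baseChange (AlgebraicClosure ℚ), f = 0) →
      AbelianVariety.IsSimple A → ∀ ℓ : ℕ, ℓ.Prime →
      (∃ ι : W.geomTorsion ℓ →+ A.geomPoints, Function.Injective ι ∧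
        ∀ (σ : Field.absoluteGaloisGroup ℚ) (P : W.geomTorsion ℓ), ι (σ • P) = σ • ι P) →
        (ℓ : ℝ) ≤ (5 + max c 0 + max C₁ 0) *
          (((A.dim : ℝ) + 1) * max 1 W.stableFaltingsHeight) ^ (max 2 (max γ κ₁)) :=
  fun _ _ hcm _ _ hγ hMW _ _ hG E A e he hfree hsimp _ hℓ hι ↦
    simpleBound_at_of_generic hcm hγ hMW hG E A e he hfree hsimp hℓ hι

end Summit.ABC.ABC.Theorems.GluingSlices

end
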